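import Literature.Analysis.FluidPDE.AntidivergenceDerivLp
import Literature.Analysis.FluidPDE.TorusLpOperatorFactsProofs
import Literature.Analysis.FluidPDE.FracLaplacianCommute
import Literature.Analysis.FluidPDE.DeRosaGluedEnergy
import Literature.Analysis.FluidPDE.LerayHopfFrac
import HarnessLib

/-!
# The hyperviscous error of the intermittent convex-integration scheme:
  `‖ℛ((-Δ)^θ w)‖_{L¹}` through `L^p` bounds of `∇w` and `∇³w` (Luo–Titi 2020, §3.5 (3.20))

Analysis/FluidPDE support file (everything proved; no named facts) for the proof of the
Iteration Lemma of T. Luo and E. S. Titi, *Non-uniqueness of weak solutions to hyperviscous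
Navier–Stokes equations: on sharpness of J.-L. Lions exponent*, Calc. Var. PDE 59 (2020) =
arXiv:1808.07595 (`Torus.LuoTiti2020_iterationLemma` of `FluidPDE/FractionalNSReynolds`). In the
stress estimate of §3.5 the hyperviscous term `ν(-Δ)^θ w_{q+1}` of the new Reynolds stress is
inverted by the anti-divergence `ℛ` and bounded by (3.20):
"`‖ℛ(ν(-Δ)^θ w_{q+1})‖_{L^∞_t L^p_x} ≲ ‖|∇|^{2θ-1} w_{q+1}‖_{L^∞_t L^p_x} ≲ r^{3/2-3/p} λ_{q+1}^{2θ-1} 𝒞₃`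
… This is the crucial estimate to control the fractional viscosity. If we assume that `p ≈ 1`,
`r ≈ λ_{q+1}`, we must have `θ < 5/4` in order that [it] is small for `λ_{q+1}` sufficiently large."
The printed chain uses `‖ℛ‖_{L^p → W^{1,p}} ≲ 1` (Lemma 5) and an interpolation of `|∇|^{2θ-1}`
between integer orders. This file PROVES the version of this estimate that the tree's operators
deliver, at a fixed time, on `𝕋^d` (`d ≥ 2`), for `1 ≤ θ < 2` and `1 < p < ∞`:

* `Torus.fracLaplacian_eq_neg_sum_partialDeriv` — the operator identity
  `(-Δ)^θ u = -∑ₘ ∂ₘ((-Δ)^{θ-1} ∂ₘu)` on smooth fields (`θ ≥ 1`; semigroup law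
  `Torus.fracLaplacian_fracLaplacian`, `(-Δ)^1 = -Δ = -∑ₘ∂ₘ∂ₘ`, and `∂ₘ(-Δ)^α = (-Δ)^α∂ₘ`);
* `Torus.exists_eLpNorm_antidivergence_fracLaplacian_le` — for `1 ≤ θ < 2`, `1 < p < ∞`:
  `‖ℛ((-Δ)^θ u)‖_{L^p} ≤ C ∑ₘ ‖∂ₘu‖_{L^p}^{2-θ} ‖Δ∂ₘu‖_{L^p}^{θ-1}` for all smooth `u`, from
  the order-zero bound `‖ℛ∂ₘ‖_{L^p→L^p} ≲ 1` (`Torus.exists_eLpNorm_antidivergence_partialDeriv_le`,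
  Calderón–Zygmund) and the moment inequality
  `‖(-Δ)^α v‖_p ≲ ‖v‖_p^{1-α} ‖Δv‖_p^α`, `α = θ - 1` (`Torus.fracLaplacian_moment_bound_holds`,
  Pazy 1983, Thm. 2.6.10) — i.e. the interpolation of the `2θ - 1 ∈ [1, 3)` derivatives that
  `ℛ(-Δ)^θ` costs between the orders `1` and `3`;
* `Torus.eLpNorm_le_of_forall_norm_le_of_eq_zero_off` — the elementary `sup × support` bound
  `‖g‖_{L^p} ≤ |E|^{1/p} sup‖g‖` for `g` vanishing off a measurable set `E` (how the intermittent
  gain `r^{3/2-3/p}` of the concentrated building blocks is booked in the tree: for a function of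
  height `H` concentrated on a set of measure `m` one has `‖g‖_{L^p} ≤ H m^{1/p}`, which for the
  blocks of the scheme is the printed `L^p` size up to constants);
* `Torus.exists_eLpNorm_one_antidivergence_fracLaplacian_le` — the two combined and brought to
  `L¹ ⊂ L^p`: `‖ℛ((-Δ)^θ u)‖_{L¹} ≤ C S₁^{2-θ} S₃^{θ-1} |E|^{1/p}` whenever the fields `∂ₘu` and
  `Δ∂ₘu` vanish off `E` and are bounded by `S₁`, `S₃` respectively.

With the sizes of the intermittent building blocks (`S₁ ~ λ`, `S₃ ~ λ³` times the block height,
`|E|` the volume fraction) the right-hand side is `λ^{2θ-1} ×` (the `L^p` size of the block),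
exactly the printed `r^{3/2-3/p} λ^{2θ-1}`.

## References

* T. Luo, E. S. Titi, Calc. Var. PDE 59 (2020) = arXiv:1808.07595, §3.5 Lemma 5, (3.20).
  [`LuoTiti2020`]
* A. Pazy, *Semigroups of Linear Operators and Applications to PDE* (1983), §2.6 Thm. 6.10.
  [`Pazy1983`]
-/

noncomputable section

open MeasureTheory Set Filter Function UnitAddTorus
open scoped ENNReal NNReal ContDiff

namespace Literature.Analysis.FluidPDE

namespace Torus

open FunctionSpaces FunctionSpaces.Torus

variable {d : Type} [Fintype d] [DecidableEq d]

/-! ## The operator identity `(-Δ)^θ = -∑ₘ ∂ₘ (-Δ)^{θ-1} ∂ₘ` -/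

/-- `(-Δ)^0 = Id` on smooth fields (the symbol `(4π²|k|²)^0` is `1` at every frequency, the zero
mode included, and a smooth field is the sum of its Fourier series). [folklore] -/
theorem fracLaplacian_zero_exponent {u : UnitAddTorus d → EuclideanSpace ℝ d} (hu : IsSmooth u) :
    fracLaplacian 0 u = u := by
  funext x
  have h1 := hasSum_fracLaplacian le_rfl hu x
  have h2 := hasSum_realPart_mFourier_smul hu x
  refine h1.unique ?_
  convert h2 using 2 with k
  simp [fracSymbol]

/-- `(-Δ)^θ` of a finite sum of smooth fields is the sum of the `(-Δ)^θ` (`θ ≥ 0`). [folklore] -/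
theorem fracLaplacian_finset_sum_of_smooth {θ : ℝ} (hθ : 0 ≤ θ) {ι : Type*} (s : Finset ι)
    {f : ι → UnitAddTorus d → EuclideanSpace ℝ d} (hf : ∀ i ∈ s, IsSmooth (f i)) :
    fracLaplacian θ (fun x => ∑ i ∈ s, f i x) = fun x => ∑ i ∈ s, fracLaplacian θ (f i) x := by
  classical
  induction s using Finset.induction_on with
  | empty =>
    simp only [Finset.sum_empty]
    exact fracLaplacian_zero_fun θ
  | insert i s hi IH =>
    have hterm : IsSmooth (f i) := hf i (Finset.mem_insert_self i s)
    have hrest' : ∀ j ∈ s, IsSmooth (f j) := fun j hj => hf j (Finset.mem_insert_of_mem hj)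
    have hrest : IsSmooth (fun x => ∑ j ∈ s, f j x) := by
      have h : (fun x => ∑ j ∈ s, f j x) = ∑ j ∈ s, f j := by
        funext x; simp only [Finset.sum_apply]
      rw [h]
      exact Finset.sum_induction _ IsSmooth (fun a b ha hb => ha.add hb) (isSmooth_const 0) hrest'
    simp only [Finset.sum_insert hi]
    rw [fracLaplacian_add hθ hterm hrest, IH hrest']

/-- **`(-Δ)^θ u = -∑ₘ ∂ₘ((-Δ)^{θ-1} ∂ₘu)`** for smooth `u` and `θ ≥ 1`: the semigroup law
`(-Δ)^θ = (-Δ)^{θ-1}(-Δ)^1`, `(-Δ)^1 = -Δ = -∑ₘ∂ₘ∂ₘ` on smooth fields, and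
`(-Δ)^{θ-1}∂ₘ = ∂ₘ(-Δ)^{θ-1}`. This is how `ℛ(-Δ)^θ` is factored through the order-zero
operators `ℛ∂ₘ`. [cite: LuoTiti2020, §3.5 (3.20)] -/
theorem fracLaplacian_eq_neg_sum_partialDeriv {θ : ℝ} (hθ : 1 ≤ θ)
    {u : UnitAddTorus d → EuclideanSpace ℝ d} (hu : IsSmooth u) :
    fracLaplacian θ u = fun x =>
      -∑ m, Torus.partialDeriv m (fracLaplacian (θ - 1) (Torus.partialDeriv m u)) x := by
  have hθ0 : 0 ≤ θ - 1 := by linarith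
  have h1 : fracLaplacian θ u = fracLaplacian (θ - 1) (fracLaplacian 1 u) := by
    rw [fracLaplacian_fracLaplacian hθ0 zero_le_one hu]
    congr 1
    ring
  have hΔ : IsSmooth (Torus.laplacian u) := hu.laplacian
  have hsum : Torus.laplacian u = fun x => ∑ m, Torus.partialDeriv m (Torus.partialDeriv m u) x :=
    funext fun x => laplacian_eq_sum_partialDeriv_partialDeriv hu x
  have hneg : -Torus.laplacian u = (-1 : ℝ) • Torus.laplacian u := by
    funext x; simp
  rw [h1, fracLaplacian_one hu, hneg, fracLaplacian_const_smul, hsum,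
    fracLaplacian_finset_sum_of_smooth hθ0 Finset.univ
      (fun m _ => (hu.partialDeriv m).partialDeriv m)]
  funext x
  simp only [Pi.smul_apply, neg_smul, one_smul]
  congr 1
  refine Finset.sum_congr rfl fun m _ => ?_
  rw [partialDeriv_fracLaplacian_comm hθ0 (hu.partialDeriv m) m]

/-! ## `‖ℛ((-Δ)^θ u)‖_{L^p}` through `‖∂ₘu‖_{L^p}` and `‖Δ∂ₘu‖_{L^p}` -/

/-- **The hyperviscous error in `L^p`** (Luo–Titi (3.20), operator part): for `d ≥ 2`,
`1 ≤ θ < 2` and `1 < p < ∞` there is `C` such that for every smooth `u : 𝕋^d → ℝ^d`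
`‖ℛ((-Δ)^θ u)‖_{L^p} ≤ C ∑ₘ ‖∂ₘu‖_{L^p}^{2-θ} ‖Δ(∂ₘu)‖_{L^p}^{θ-1}`. From
`(-Δ)^θu = -∑ₘ∂ₘ((-Δ)^{θ-1}∂ₘu)`, the `L^p` bound of `ℛ∂ₘ`
(`exists_eLpNorm_antidivergence_partialDeriv_le`) and the moment inequality for `(-Δ)^{θ-1}`
(`fracLaplacian_moment_bound_holds`; for `θ = 1`, `(-Δ)^0 = Id`). [cite: LuoTiti2020, §3.5 (3.20)] -/
theorem exists_eLpNorm_antidivergence_fracLaplacian_le (hd : 2 ≤ Fintype.card d) {θ : ℝ}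
    (hθ1 : 1 ≤ θ) (hθ2 : θ < 2) {p : ℝ≥0∞} (hp1 : 1 < p) (hp : p < ⊤) :
    ∃ C : ℝ≥0, ∀ u : UnitAddTorus d → EuclideanSpace ℝ d, IsSmooth u →
      eLpNorm (antidivergence (fracLaplacian θ u)) p volume ≤
        C * ∑ m, eLpNorm (Torus.partialDeriv m u) p volume ^ (2 - θ) *
          eLpNorm (Torus.laplacian (Torus.partialDeriv m u)) p volume ^ (θ - 1) := by
  have hθ0 : 0 ≤ θ - 1 := by linarith
  obtain ⟨CR, hCR⟩ := exists_eLpNorm_antidivergence_partialDeriv_le (d := d) hd hp1 hp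
  -- the bound of `B_m = (-Δ)^{θ-1}(∂ₘu)` in `L^p`, uniformly in smooth `v = ∂ₘu`
  obtain ⟨CM, hCM⟩ : ∃ CM : ℝ≥0, ∀ v : UnitAddTorus d → EuclideanSpace ℝ d, IsSmooth v →
      eLpNorm (fracLaplacian (θ - 1) v) p volume ≤
        CM * eLpNorm v p volume ^ (2 - θ) * eLpNorm (Torus.laplacian v) p volume ^ (θ - 1) := by
    rcases eq_or_lt_of_le hθ1 with h | h
    · refine ⟨1, fun v hv => ?_⟩
      subst h
      rw [show (1 : ℝ) - 1 = 0 by norm_num, fracLaplacian_zero_exponent hv,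
        show (2 : ℝ) - 1 = 1 by norm_num, ENNReal.rpow_one, ENNReal.rpow_zero]
      simp
    · obtain ⟨CM, hCM⟩ := fracLaplacian_moment_bound_holds (d := d) (θ - 1) (by linarith) (by linarith) p hp1 hp
      refine ⟨CM, fun v hv => ?_⟩
      have := hCM v hv
      rwa [show (1 : ℝ) - (θ - 1) = 2 - θ by ring] at this
  refine ⟨CR * CM, fun u hu => ?_⟩
  set B : d → UnitAddTorus d → EuclideanSpace ℝ d := fun m => fracLaplacian (θ - 1) (Torus.partialDeriv m u)
    with hB_def
  have hBs : ∀ m, IsSmooth (B m) := fun m => (hu.partialDeriv m).fracLaplacian hθ0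
  have hdBs : ∀ m, IsSmooth (Torus.partialDeriv m (B m)) := fun m => (hBs m).partialDeriv m
  -- `ℛ((-Δ)^θ u) = -∑ₘ ℛ(∂ₘ B_m)`
  have hdec : fracLaplacian θ u = -∑ m, Torus.partialDeriv m (B m) := by
    rw [fracLaplacian_eq_neg_sum_partialDeriv hθ1 hu]
    funext x
    simp only [Pi.neg_apply, Finset.sum_apply, hB_def]
  have hsumS : IsSmooth (∑ m, Torus.partialDeriv m (B m)) :=
    Finset.sum_induction _ IsSmooth (fun a b ha hb => ha.add hb) (isSmooth_const 0) fun m _ => hdBs m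
  have hR : antidivergence (fracLaplacian θ u) = -∑ m, antidivergence (Torus.partialDeriv m (B m)) := by
    rw [hdec, antidivergence_neg hsumS, antidivergence_finset_sum Finset.univ (fun m _ => hdBs m)]
  have hmeas : ∀ m, AEStronglyMeasurable (antidivergence (Torus.partialDeriv m (B m))) volume :=
    fun m => (isSmooth_antidivergence (hdBs m)).continuous.aestronglyMeasurable
  rw [hR, eLpNorm_neg]
  calc eLpNorm (∑ m, antidivergence (Torus.partialDeriv m (B m))) p volume
      ≤ ∑ m, eLpNorm (antidivergence (Torus.partialDeriv m (B m))) p volume :=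
        eLpNorm_sum_le (fun m _ => hmeas m) hp1.le
    _ ≤ ∑ m, (CR : ℝ≥0∞) * eLpNorm (B m) p volume :=
        Finset.sum_le_sum fun m _ => hCR (B m) (hBs m) m
    _ ≤ ∑ m, (CR : ℝ≥0∞) * (CM * eLpNorm (Torus.partialDeriv m u) p volume ^ (2 - θ) *
          eLpNorm (Torus.laplacian (Torus.partialDeriv m u)) p volume ^ (θ - 1)) :=
        Finset.sum_le_sum fun m _ => mul_le_mul' le_rfl (hCM _ (hu.partialDeriv m))
    _ = ((CR * CM : ℝ≥0) : ℝ≥0∞) * ∑ m, eLpNorm (Torus.partialDeriv m u) p volume ^ (2 - θ) *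
          eLpNorm (Torus.laplacian (Torus.partialDeriv m u)) p volume ^ (θ - 1) := by
        rw [Finset.mul_sum]
        refine Finset.sum_congr rfl fun m _ => ?_
        push_cast
        ring

/-! ## `sup × support` -/

omit [DecidableEq d] in
/-- **`‖g‖_{L^p} ≤ |E|^{1/p} sup‖g‖` for `g` vanishing off the measurable set `E`** (any
exponent `p`; `|E|^{1/p}` is `volume E ^ (1/p.toReal)`, so the factor is `1` at `p = ∞`). For a
field of height `H` concentrated on a set of measure `m` this is the intermittent `L^p` size
`H m^{1/p}` of the building blocks of the scheme. [folklore] -/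
theorem eLpNorm_le_of_forall_norm_le_of_eq_zero_off {F : Type*} [NormedAddCommGroup F]
    {g : UnitAddTorus d → F} {E : Set (UnitAddTorus d)} (hE : MeasurableSet E)
    (hg : ∀ y ∉ E, g y = 0) {S : ℝ} (hS : ∀ y, ‖g y‖ ≤ S) (p : ℝ≥0∞) :
    eLpNorm g p volume ≤ volume E ^ (1 / p.toReal) * ENNReal.ofReal S := by
  have hind : g = E.indicator g := by
    funext y
    by_cases hy : y ∈ E
    · simp [hy]
    · simp [hy, hg y hy]
  rw [hind, eLpNorm_indicator_eq_eLpNorm_restrict hE]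
  calc eLpNorm g p (volume.restrict E)
      ≤ (volume.restrict E) univ ^ p.toReal⁻¹ * ENNReal.ofReal S :=
        eLpNorm_le_of_ae_bound (Eventually.of_forall hS)
    _ = volume E ^ (1 / p.toReal) * ENNReal.ofReal S := by
        rw [Measure.restrict_apply_univ, one_div]

/-! ## The combined `L¹` bound -/

/-- Bookkeeping: `(m^r S₁)^{2-θ} (m^r S₃)^{θ-1} = m^r (S₁^{2-θ} S₃^{θ-1})` in `ℝ≥0∞` for
`1 ≤ θ ≤ 2`, `r ≥ 0`. [folklore] -/
theorem rpow_mul_rpow_bookkeeping {θ : ℝ} (hθ1 : 1 ≤ θ) (hθ2 : θ ≤ 2) (m : ℝ≥0∞) {r : ℝ}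
    (hr : 0 ≤ r) {S₁ S₃ : ℝ} (hS₁ : 0 ≤ S₁) (hS₃ : 0 ≤ S₃) :
    (m ^ r * ENNReal.ofReal S₁) ^ (2 - θ) * (m ^ r * ENNReal.ofReal S₃) ^ (θ - 1) =
      m ^ r * ENNReal.ofReal (S₁ ^ (2 - θ) * S₃ ^ (θ - 1)) := by
  have ha : 0 ≤ 2 - θ := by linarith
  have hb : 0 ≤ θ - 1 := by linarith
  rw [ENNReal.mul_rpow_of_nonneg _ _ ha, ENNReal.mul_rpow_of_nonneg _ _ hb,
    ← ENNReal.rpow_mul, ← ENNReal.rpow_mul, ENNReal.ofReal_rpow_of_nonneg hS₁ ha,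
    ENNReal.ofReal_rpow_of_nonneg hS₃ hb, ENNReal.ofReal_mul (Real.rpow_nonneg hS₁ _)]
  have hsplit : m ^ r = m ^ (r * (2 - θ)) * m ^ (r * (θ - 1)) := by
    rw [← ENNReal.rpow_add_of_nonneg _ _ (mul_nonneg hr ha) (mul_nonneg hr hb)]
    congr 1
    ring
  rw [hsplit]
  ring

/-- **The hyperviscous error in `L¹` by `sup × support`** (Luo–Titi (3.20) as used in the
scheme): for `d ≥ 2`, `1 ≤ θ < 2`, `1 < p < ∞` there is `C` such that for every smooth
`u : 𝕋^d → ℝ^d` whose derivatives `∂ₘu`, `Δ∂ₘu` vanish off a measurable set `E` and are bounded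
by `S₁`, `S₃`,
`‖ℛ((-Δ)^θ u)‖_{L¹} ≤ C |E|^{1/p} S₁^{2-θ} S₃^{θ-1}`
(`L¹ ≤ L^p` on the probability space `𝕋^d`, `exists_eLpNorm_antidivergence_fracLaplacian_le`,
`eLpNorm_le_of_forall_norm_le_of_eq_zero_off`). For the perturbation of the scheme (blocks of
height `H`, frequency `λ`, volume fraction `|E|`) this reads `λ^{2θ-1} · H|E|^{1/p}`, small for
`λ` large exactly in the printed range of exponents. [cite: LuoTiti2020, §3.5 (3.20)] -/
theorem exists_eLpNorm_one_antidivergence_fracLaplacian_le (hd : 2 ≤ Fintype.card d) {θ : ℝ}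
    (hθ1 : 1 ≤ θ) (hθ2 : θ < 2) {p : ℝ≥0∞} (hp1 : 1 < p) (hp : p < ⊤) :
    ∃ C : ℝ≥0, ∀ u : UnitAddTorus d → EuclideanSpace ℝ d, IsSmooth u →
      ∀ E : Set (UnitAddTorus d), MeasurableSet E →
      (∀ m, ∀ y ∉ E, Torus.partialDeriv m u y = 0) →
      (∀ m, ∀ y ∉ E, Torus.laplacian (Torus.partialDeriv m u) y = 0) →
      ∀ S₁ S₃ : ℝ, 0 ≤ S₁ → 0 ≤ S₃ →
      (∀ m y, ‖Torus.partialDeriv m u y‖ ≤ S₁) →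
      (∀ m y, ‖Torus.laplacian (Torus.partialDeriv m u) y‖ ≤ S₃) →
      eLpNorm (antidivergence (fracLaplacian θ u)) 1 volume ≤
        C * (volume E ^ (1 / p.toReal) * ENNReal.ofReal (S₁ ^ (2 - θ) * S₃ ^ (θ - 1))) := by
  obtain ⟨C, hC⟩ := exists_eLpNorm_antidivergence_fracLaplacian_le hd hθ1 hθ2 hp1 hp
  refine ⟨C * Fintype.card d, fun u hu E hE h1 h3 S₁ S₃ hS₁ hS₃ hb1 hb3 => ?_⟩
  have ha : 0 ≤ 2 - θ := by linarith
  have hb : 0 ≤ θ - 1 := by linarith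
  have hsm : IsSmooth (antidivergence (fracLaplacian θ u)) :=
    isSmooth_antidivergence (hu.fracLaplacian (by linarith))
  have hL1 : eLpNorm (antidivergence (fracLaplacian θ u)) 1 volume ≤
      eLpNorm (antidivergence (fracLaplacian θ u)) p volume :=
    eLpNorm_le_eLpNorm_of_exponent_le hp1.le hsm.continuous.aestronglyMeasurable
  refine hL1.trans ((hC u hu).trans ?_)
  set K : ℝ≥0∞ := volume E ^ (1 / p.toReal) * ENNReal.ofReal (S₁ ^ (2 - θ) * S₃ ^ (θ - 1)) with hK
  have hterm : ∀ m, eLpNorm (Torus.partialDeriv m u) p volume ^ (2 - θ) *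
      eLpNorm (Torus.laplacian (Torus.partialDeriv m u)) p volume ^ (θ - 1) ≤ K := by
    intro m
    have e1 := eLpNorm_le_of_forall_norm_le_of_eq_zero_off hE (h1 m) (hb1 m) p
    have e3 := eLpNorm_le_of_forall_norm_le_of_eq_zero_off hE (h3 m) (hb3 m) p
    calc eLpNorm (Torus.partialDeriv m u) p volume ^ (2 - θ) *
          eLpNorm (Torus.laplacian (Torus.partialDeriv m u)) p volume ^ (θ - 1)
        ≤ (volume E ^ (1 / p.toReal) * ENNReal.ofReal S₁) ^ (2 - θ) *
          (volume E ^ (1 / p.toReal) * ENNReal.ofReal S₃) ^ (θ - 1) :=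
          mul_le_mul' (ENNReal.rpow_le_rpow e1 ha) (ENNReal.rpow_le_rpow e3 hb)
      _ = K := rpow_mul_rpow_bookkeeping hθ1 hθ2.le _ (by positivity) hS₁ hS₃
  calc (C : ℝ≥0∞) * ∑ m, eLpNorm (Torus.partialDeriv m u) p volume ^ (2 - θ) *
          eLpNorm (Torus.laplacian (Torus.partialDeriv m u)) p volume ^ (θ - 1)
      ≤ C * ∑ _m : d, K := mul_le_mul' le_rfl (Finset.sum_le_sum fun m _ => hterm m)
    _ = ((C * Fintype.card d : ℝ≥0) : ℝ≥0∞) * K := by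
        rw [Finset.sum_const, Finset.card_univ, nsmul_eq_mul]
        push_cast
        ring

end Torus

end Literature.Analysis.FluidPDE
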